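import Summits.KontsevichZagierPeriods.KontsevichZagierPeriods.Theorems.HyperbolicBlochOffTetraSectorKernelPolytopeEnvelopeFloor
import Literature.NumberTheory.Transcendental.KZCalculusProofs

/-!
# Towards `stub_polytopeEnvelope`, the normalised cusp is boxed — crux `OffTetraSectorKernel` (v5, lead c3)

`polyEnv_image_boxed`: the Möbius image `Q` of a cusp piece of a finite-volume normal-form polytope has an explicit
algebraic normal form and lies in a box `{|q| < M', δ' < t}`: bounded shadow by floor clearance (a) for `Q`
(every transformed constraint is again negative somewhere), floor-freeness by `polyEnv_free_ball_at_floor_point`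
made uniform over the compact floor disc by a Lebesgue number.

References: R. Benedetti, C. Petronio, *Lectures on Hyperbolic Geometry* (1992), A.3.5.
-/

noncomputable section

open Set MeasureTheory Filter Topology
open Literature.NumberTheory.Transcendental

namespace Summit.KontsevichZagierPeriods.HyperbolicBloch.OffTetraSectorKernel

/-! ### The normalised cusp lies in a box `{|q| < M', δ' < t}` -/

/-- **The normalised cusp is boxed.** For a finite-volume normal-form polytope `P` (nonempty, every constraint
negative somewhere) with finitely many floor candidates, a candidate-or-not floor point `n` all of whose fellow
candidates are `> 2ρ` away, and the Möbius image `Q` of the cusp piece `P ∩ ball((n,0), ρ)` (on which `t⁻³` is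
integrable): `Q` has an explicit algebraic normal form and lies in a box `{|q| < M', δ' < t}` — bounded shadow by
floor clearance (a) for `Q`, floor-freeness by `polyEnv_free_ball_at_floor_point` made uniform on the compact floor
disc by a Lebesgue number. [cite: BenedettiPetronio1992, A.3.5] -/
theorem polyEnv_image_boxed : ∀ (Ql : (Fin 3 → ℝ) → Fin 4 → ℝ),
    (∀ p, Ql p = ![p 0 ^ 2 + p 1 ^ 2 + p 2 ^ 2, p 0, p 1, 1]) →
    (∀ (k : ℕ) (L : Fin k → Fin 4 → ℝ) (P : Set (Fin 3 → ℝ)),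
      P = {p | 0 < p 2 ∧ ∀ i, 0 < ∑ c, L i c * Ql p c} → P.Nonempty →
      (∀ i, ∃ p : Fin 3 → ℝ, 0 < p 2 ∧ ∑ c, L i c * Ql p c < 0) →
      IntegrableOn (fun p : Fin 3 → ℝ => 1 / p 2 ^ 3) P →
      (∃ M : ℝ, ∀ p ∈ P, p 0 ^ 2 + p 1 ^ 2 < M ^ 2) ∧
      (∀ η : ℝ, 0 < η → ∃ δ : ℝ, 0 < δ ∧ ∀ p ∈ P, p 2 < δ → ∃ n : Fin 2 → ℝ,
        (∃ i j, i ≠ j ∧ L i 0 * (n 0 ^ 2 + n 1 ^ 2) + L i 1 * n 0 + L i 2 * n 1 + L i 3 = 0 ∧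
            L j 0 * (n 0 ^ 2 + n 1 ^ 2) + L j 1 * n 0 + L j 2 * n 1 + L j 3 = 0) ∧
        (p 0 - n 0) ^ 2 + (p 1 - n 1) ^ 2 < η ^ 2)) →
    ∀ (k : ℕ) (L : Fin k → Fin 4 → ℝ), (∀ i c, IsAlgebraic ℚ (L i c)) →
    ∀ (P : Set (Fin 3 → ℝ)), P = {p | 0 < p 2 ∧ ∀ i, 0 < ∑ c, L i c * Ql p c} → P.Nonempty →
      (∀ i, ∃ p : Fin 3 → ℝ, 0 < p 2 ∧ ∑ c, L i c * Ql p c < 0) →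
      IntegrableOn (fun p : Fin 3 → ℝ => 1 / p 2 ^ 3) P →
      Set.Finite {c : Fin 2 → ℝ | ∃ i j, i ≠ j ∧
        L i 0 * (c 0 ^ 2 + c 1 ^ 2) + L i 1 * c 0 + L i 2 * c 1 + L i 3 = 0 ∧
        L j 0 * (c 0 ^ 2 + c 1 ^ 2) + L j 1 * c 0 + L j 2 * c 1 + L j 3 = 0} →
    ∀ (n : Fin 2 → ℝ), (∀ l, IsAlgebraic ℚ (n l)) → ∀ (ρ : ℝ), 0 < ρ → IsAlgebraic ℚ ρ →
      (∀ c₀ ∈ {c : Fin 2 → ℝ | ∃ i j, i ≠ j ∧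
          L i 0 * (c 0 ^ 2 + c 1 ^ 2) + L i 1 * c 0 + L i 2 * c 1 + L i 3 = 0 ∧
          L j 0 * (c 0 ^ 2 + c 1 ^ 2) + L j 1 * c 0 + L j 2 * c 1 + L j 3 = 0},
        c₀ ≠ n → (2 * ρ) ^ 2 < (c₀ 0 - n 0) ^ 2 + (c₀ 1 - n 1) ^ 2) →
    ∀ (Q : Set (Fin 3 → ℝ)), Q = KZ.unitInversion 2 '' (KZ.boundarySimilarity 2 1 1 ![-n 0, -n 1] ''
        (P ∩ {p | (p 0 - n 0) ^ 2 + (p 1 - n 1) ^ 2 + p 2 ^ 2 < ρ ^ 2})) →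
      IntegrableOn (fun p : Fin 3 → ℝ => 1 / p 2 ^ 3) Q →
      ∃ (M' δ' : ℝ) (LQ : Fin (k + 1) → Fin 4 → ℝ), 0 < M' ∧ 0 < δ' ∧ (∀ i c, IsAlgebraic ℚ (LQ i c)) ∧
        Q = {q | 0 < q 2 ∧ ∀ i, 0 < ∑ c, LQ i c * Ql q c} ∧
        Q ⊆ {q | q 0 ^ 2 + q 1 ^ 2 < M' ^ 2 ∧ δ' < q 2} := by
  intro Ql hQl hClear k L hLalg P hP hPne hND1 hInt hCfin n hnalg ρ hρ hρalg hsep Q hQ hQint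
  classical
  have hPsub : P ⊆ {p | 0 < p 2} := by
    rw [hP]
    exact fun p hp => hp.1
  /- 1. non-candidates of `P` are not approached -/
  obtain ⟨-, hclP⟩ := hClear k L P hP hPne hND1 hInt
  have hfree : ∀ c₀ : Fin 2 → ℝ, c₀ ∉ {c : Fin 2 → ℝ | ∃ i j, i ≠ j ∧
      L i 0 * (c 0 ^ 2 + c 1 ^ 2) + L i 1 * c 0 + L i 2 * c 1 + L i 3 = 0 ∧
      L j 0 * (c 0 ^ 2 + c 1 ^ 2) + L j 1 * c 0 + L j 2 * c 1 + L j 3 = 0} →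
      ∃ ε : ℝ, 0 < ε ∧ ∀ p ∈ P, ε ^ 2 ≤ (p 0 - c₀ 0) ^ 2 + (p 1 - c₀ 1) ^ 2 + p 2 ^ 2 :=
    fun c₀ hc₀ => polyEnv_free_ball_of_not_candidate hCfin (fun η hη => by
      obtain ⟨δ, hδ, h⟩ := hclP η hη
      exact ⟨δ, hδ, fun p hp hpt => h p hp hpt⟩) hPsub c₀ hc₀
  /- 2. every floor point has a `Q`-free ball -/
  have hfloor : ∀ c : Fin 2 → ℝ, ∃ ε : ℝ, 0 < ε ∧ ∀ q ∈ Q, ε ^ 2 ≤ (q 0 - c 0) ^ 2 + (q 1 - c 1) ^ 2 + q 2 ^ 2 :=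
    polyEnv_free_ball_at_floor_point P hPsub _ n ρ hρ hsep hfree Q hQ
  /- 3. the normal form of `Q` -/
  set brow : Fin 4 → ℝ := ![-1, 2 * n 0, 2 * n 1, ρ ^ 2 - (n 0 ^ 2 + n 1 ^ 2)] with hbrow
  set M : Fin (k + 1) → Fin 4 → ℝ := Fin.cons brow L with hM
  have hMalg : ∀ i c, IsAlgebraic ℚ (M i c) := by
    intro i
    refine Fin.cases ?_ (fun i' => ?_) i
    · intro c
      simp only [hM, Fin.cons_zero, hbrow]
      fin_cases c
      · simpa using isAlgebraic_one.neg
      · simpa using (isAlgebraic_nat 2).mul (hnalg 0)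
      · simpa using (isAlgebraic_nat 2).mul (hnalg 1)
      · simpa using (hρalg.pow 2).sub (((hnalg 0).pow 2).add ((hnalg 1).pow 2))
    · intro c
      simpa [hM] using hLalg i' c
  have hPball : P ∩ {p | (p 0 - n 0) ^ 2 + (p 1 - n 1) ^ 2 + p 2 ^ 2 < ρ ^ 2} =
      {p | 0 < p 2 ∧ ∀ i, 0 < ∑ c, M i c * Ql p c} := by
    rw [hP]
    ext p
    simp only [mem_inter_iff, mem_setOf_eq, hM, Fin.forall_fin_succ, Fin.cons_zero, Fin.cons_succ]
    have e : ∑ c, brow c * Ql p c = ρ ^ 2 - ((p 0 - n 0) ^ 2 + (p 1 - n 1) ^ 2 + p 2 ^ 2) := by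
      simp only [hbrow, hQl, Fin.sum_univ_four, Matrix.cons_val_zero, Matrix.cons_val_one, Matrix.cons_val_two,
        Matrix.cons_val_three, Matrix.head_cons, Matrix.tail_cons]
      ring
    rw [e]
    constructor
    · rintro ⟨⟨h0, hall⟩, hb⟩
      exact ⟨h0, by linarith, hall⟩
    · rintro ⟨h0, hb, hall⟩
      exact ⟨⟨h0, hall⟩, by linarith⟩
  set LQ : Fin (k + 1) → Fin 4 → ℝ := fun i =>
    ![M i 0 * (n 0 ^ 2 + n 1 ^ 2) + M i 1 * n 0 + M i 2 * n 1 + M i 3, 2 * n 0 * M i 0 + M i 1,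
      2 * n 1 * M i 0 + M i 2, M i 0] with hLQ
  have hQnf : Q = {q | 0 < q 2 ∧ ∀ i, 0 < ∑ c, LQ i c * Ql q c} := by
    rw [hQ]
    exact polyEnv_image_normalForm Ql hQl (k + 1) M n _ hPball
  have hLQalg : ∀ i c, IsAlgebraic ℚ (LQ i c) := by
    intro i c
    simp only [hLQ]
    fin_cases c
    · simpa using ((((hMalg i 0).mul (((hnalg 0).pow 2).add ((hnalg 1).pow 2))).add ((hMalg i 1).mul (hnalg 0))).add
        ((hMalg i 2).mul (hnalg 1))).add (hMalg i 3)
    · simpa using (((isAlgebraic_nat 2).mul (hnalg 0)).mul (hMalg i 0)).add (hMalg i 1)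
    · simpa using (((isAlgebraic_nat 2).mul (hnalg 1)).mul (hMalg i 0)).add (hMalg i 2)
    · simpa using hMalg i 0
  /- 4. bounded shadow of `Q` -/
  have hshadow : ∃ M₀ : ℝ, 0 < M₀ ∧ ∀ q ∈ Q, q 0 ^ 2 + q 1 ^ 2 < M₀ ^ 2 := by
    by_cases hQe : Q = ∅
    · exact ⟨1, one_pos, by simp [hQe]⟩
    have hQne : Q.Nonempty := nonempty_iff_ne_empty.mpr hQe
    have hND1Q : ∀ i, ∃ q : Fin 3 → ℝ, 0 < q 2 ∧ ∑ c, LQ i c * Ql q c < 0 := by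
      intro i
      refine Fin.cases ?_ (fun i' => ?_) i
      · refine ⟨![0, 0, ρ⁻¹ / 2], by simp; positivity, ?_⟩
        simp only [hLQ, hM, Fin.cons_zero, hbrow, hQl, Fin.sum_univ_four, Matrix.cons_val_zero, Matrix.cons_val_one,
          Matrix.cons_val_two, Matrix.cons_val_three, Matrix.head_cons, Matrix.tail_cons]
        field_simp
        nlinarith
      · obtain ⟨p, hp2, hneg⟩ := hND1 i'
        obtain ⟨hback, hq2⟩ := polyEnv_back_apply n p hp2
        set q := KZ.unitInversion 2 ![p 0 - n 0, p 1 - n 1, p 2] with hq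
        have hS : 0 < q 0 ^ 2 + q 1 ^ 2 + q 2 ^ 2 := by positivity
        refine ⟨q, hq2, ?_⟩
        have key := polyEnv_constraint_transform Ql hQl (L i') n q hS.ne'
        rw [hback] at key
        have : ∑ c, LQ (Fin.succ i') c * Ql q c = ∑ c, (![L i' 0 * (n 0 ^ 2 + n 1 ^ 2) + L i' 1 * n 0 + L i' 2 * n 1 +
            L i' 3, 2 * n 0 * L i' 0 + L i' 1, 2 * n 1 * L i' 0 + L i' 2, L i' 0] : Fin 4 → ℝ) c * Ql q c := by
          simp [hLQ, hM]
        rw [this]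
        have h2 : (∑ c, (![L i' 0 * (n 0 ^ 2 + n 1 ^ 2) + L i' 1 * n 0 + L i' 2 * n 1 + L i' 3, 2 * n 0 * L i' 0 + L i' 1,
            2 * n 1 * L i' 0 + L i' 2, L i' 0] : Fin 4 → ℝ) c * Ql q c) / (q 0 ^ 2 + q 1 ^ 2 + q 2 ^ 2) < 0 := by
          rw [← key]; exact hneg
        rw [div_lt_iff₀ hS, zero_mul] at h2
        exact h2
    obtain ⟨⟨M₀, hM₀⟩, -⟩ := hClear (k + 1) LQ Q hQnf hQne hND1Q hQint
    refine ⟨|M₀| + 1, by positivity, fun q hq => ?_⟩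
    have := hM₀ q hq
    nlinarith [abs_nonneg M₀, sq_abs M₀]
  obtain ⟨M', hM'pos, hM'⟩ := hshadow
  /- 5. uniform floor-freeness over the compact floor disc -/
  choose εf hεf hfreef using hfloor
  set K : Set (Fin 3 → ℝ) := (fun c : Fin 2 → ℝ => (![c 0, c 1, 0] : Fin 3 → ℝ)) ''
    Metric.closedBall (0 : Fin 2 → ℝ) M' with hK
  have hKc : IsCompact K := by
    refine (isCompact_closedBall _ _).image (continuous_pi fun l => ?_)
    fin_cases l
    · exact continuous_apply 0
    · exact continuous_apply 1
    · exact continuous_const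
  set U : (Fin 2 → ℝ) → Set (Fin 3 → ℝ) := fun c =>
    {q | (q 0 - c 0) ^ 2 + (q 1 - c 1) ^ 2 + q 2 ^ 2 < εf c ^ 2} with hU
  have hUo : ∀ c, IsOpen (U c) := fun c => by
    simp only [hU]
    exact isOpen_lt (by fun_prop) continuous_const
  have hcover : K ⊆ ⋃ c, U c := by
    rintro x ⟨c, -, rfl⟩
    refine mem_iUnion.mpr ⟨c, ?_⟩
    simp only [hU, mem_setOf_eq, Matrix.cons_val_zero, Matrix.cons_val_one, Matrix.cons_val_two, Matrix.head_cons,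
      Matrix.tail_cons, sub_self]
    nlinarith [hεf c]
  obtain ⟨δ, hδ, hleb⟩ := lebesgue_number_lemma_of_metric hKc hUo hcover
  refine ⟨M', δ / 2, LQ, hM'pos, by positivity, hLQalg, hQnf, fun q hq => ⟨hM' q hq, ?_⟩⟩
  by_contra hle
  push Not at hle
  have hq2 : 0 < q 2 := by
    rw [hQnf] at hq
    exact hq.1
  -- the floor point below `q` is in `K`
  have hx : (![q 0, q 1, 0] : Fin 3 → ℝ) ∈ K := by
    refine ⟨![q 0, q 1], ?_, ?_⟩
    · rw [Metric.mem_closedBall, dist_zero_right, pi_norm_le_iff_of_nonneg hM'pos.le]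
      have hb := hM' q hq
      have h0 : |q 0| ≤ M' := abs_le_of_sq_le_sq' (by nlinarith [sq_nonneg (q 1)]) hM'pos.le |> fun h => abs_le.mpr h
      have h1 : |q 1| ≤ M' := abs_le_of_sq_le_sq' (by nlinarith [sq_nonneg (q 0)]) hM'pos.le |> fun h => abs_le.mpr h
      intro l
      fin_cases l
      · simpa [Real.norm_eq_abs] using h0
      · simpa [Real.norm_eq_abs] using h1
    · ext l
      fin_cases l <;> simp
  obtain ⟨c, hc⟩ := hleb _ hx
  have hqball : q ∈ Metric.ball (![q 0, q 1, 0] : Fin 3 → ℝ) δ := by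
    rw [Metric.mem_ball, dist_pi_lt_iff hδ]
    intro l
    fin_cases l
    · simp
      exact hδ
    · simp
      exact hδ
    · show dist (q 2) 0 < δ
      rw [Real.dist_eq, sub_zero, abs_of_pos hq2]
      linarith
  have hqU := hc hqball
  simp only [hU, mem_setOf_eq] at hqU
  have := hfreef c q hq
  linarith


end Summit.KontsevichZagierPeriods.HyperbolicBloch.OffTetraSectorKernel

end
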